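import Literature.Analysis.FluidPDE.OseenKernelLineIntegrals
import Literature.Analysis.FluidPDE.OseenDuhamelMeasurable
import Literature.Analysis.FluidPDE.NSBoundedMildOseenDuhamel
import Literature.Analysis.FluidPDE.MildSolution
import Literature.Analysis.FluidPDE.SelfSimilar
import Literature.Analysis.FluidPDE.WeakSolution
import Literature.Analysis.FluidPDE.VectorCalculus
import Literature.Analysis.UnboundedOperators.HeatKernelHeatEquation
import Literature.Analysis.UnboundedOperators.HeatKernelBoundedData
import HarnessLib

/-!
# Crux `FiniteTangentModuliMild` (stmt-NavierStokesRegularity-14049), line `packing-observability`: STUB 1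

LINEAR CLOSURE of the x-bounded tempered linearised-mild tangent class about a Type-I drift — the
registered stub `stub_classLinear` of the line's skeleton
(`Cruxes/FiniteTangentModuliMild/Lines/packing-observability.lean`), with the six conjuncts of the class
(`Theorems.FiniteTangentModuliMild.Negative.TrivialSectors.InTangentClass`) spelled out. Helper file for
the crux item (lands `--supports stmt-NavierStokesRegularity-14049`).

## Proof

Conjunct by conjunct for `(a v₁ + b v₂, a q₁ + b q₂)` (helpers `classLinear_*`): joint smoothness
(`ContDiffOn.add/const_smul/mul`); envelopes with constant `|a| K₁ + |b| K₂`; `div`, `timeDeriv`,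
`convect`, `Δ` (`ContDiffAt.laplacian_add`, `laplacian_smul`) and `gradient` are linear on the smooth
slices at `t < 0` (interior points of `Iio 0 ×ˢ univ`); the Oseen identity — for `t − s > 0`,
`heatFlow = heatExtension` is linear on bounded continuous data (`heatExtension_add_of_bound`,
`heatExtension_const_smul`), and the symmetrised double Oseen integral is linear in the member because
its integrand is integrable on `(s,t) × ℝ³` (`integrable_oseenKernel_duhamel_bounded`, KNSS 2009 §4 /
Koch–Tataru (14): on `(s,t) ⊂ (−∞,0)` the drift is bounded by `|C|/√(−t)`, the members by
`|Kᵢ|/√(−t) + |Kᵢ|/(−t)`, all continuous), so both levels of `∫∫` split (Fubini slices and marginals).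
-/

noncomputable section

open Set Function Filter Topology Metric MeasureTheory InnerProductSpace
open scoped Laplacian ContDiff
open Literature.Analysis Literature.Analysis.FluidPDE

set_option linter.dupNamespace false

namespace Summit.NavierStokesRegularity.NavierStokesRegularity.Theorems

/-- Local notation for physical space `ℝ³ = EuclideanSpace ℝ (Fin 3)` (as in the registered skeleton). -/
local notation "ℝ³" => EuclideanSpace ℝ (Fin 3)

section Slices

variable {F : Type*} [NormedAddCommGroup F] [NormedSpace ℝ F]

/-- A field smooth on the open set `(-∞,0) × ℝ³` is smooth at each of its points. [folklore] -/
theorem classLinear_contDiffAt_uncurry {v : ℝ → ℝ³ → F}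
    (hv : ContDiffOn ℝ (⊤ : ℕ∞) (uncurry v) (Iio 0 ×ˢ univ)) {t : ℝ} (ht : t < 0) (x : ℝ³) :
    ContDiffAt ℝ (⊤ : ℕ∞) (uncurry v) (t, x) :=
  hv.contDiffAt ((isOpen_Iio.prod isOpen_univ).mem_nhds ⟨ht, mem_univ _⟩)

/-- Spatial slices at negative times of a field smooth on `(-∞,0) × ℝ³` are smooth. [folklore] -/
theorem classLinear_contDiffAt_slice {v : ℝ → ℝ³ → F}
    (hv : ContDiffOn ℝ (⊤ : ℕ∞) (uncurry v) (Iio 0 ×ˢ univ)) {t : ℝ} (ht : t < 0) (x : ℝ³) :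
    ContDiffAt ℝ (⊤ : ℕ∞) (v t) x :=
  (classLinear_contDiffAt_uncurry hv ht x).comp x (contDiffAt_const.prodMk contDiffAt_id)

/-- Spatial slices at negative times of a field smooth on `(-∞,0) × ℝ³` are differentiable. [folklore] -/
theorem classLinear_differentiableAt_slice {v : ℝ → ℝ³ → F}
    (hv : ContDiffOn ℝ (⊤ : ℕ∞) (uncurry v) (Iio 0 ×ˢ univ)) {t : ℝ} (ht : t < 0) (x : ℝ³) :
    DifferentiableAt ℝ (v t) x :=
  (classLinear_contDiffAt_slice hv ht x).differentiableAt (by simp)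

/-- Time slices at negative times of a field smooth on `(-∞,0) × ℝ³` are differentiable. [folklore] -/
theorem classLinear_differentiableAt_time {v : ℝ → ℝ³ → F}
    (hv : ContDiffOn ℝ (⊤ : ℕ∞) (uncurry v) (Iio 0 ×ˢ univ)) {t : ℝ} (ht : t < 0) (x : ℝ³) :
    DifferentiableAt ℝ (fun s => v s x) t :=
  ((classLinear_contDiffAt_uncurry hv ht x).comp t
    (contDiffAt_id.prodMk contDiffAt_const)).differentiableAt (by simp)

/-- Spatial slices at negative times of a field smooth on `(-∞,0) × ℝ³` are continuous. [folklore] -/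
theorem classLinear_continuous_slice {v : ℝ → ℝ³ → F}
    (hv : ContDiffOn ℝ (⊤ : ℕ∞) (uncurry v) (Iio 0 ×ˢ univ)) {t : ℝ} (ht : t < 0) :
    Continuous (v t) :=
  continuous_iff_continuousAt.2 fun x => (classLinear_contDiffAt_slice hv ht x).continuousAt

/-- Conjunct 1: joint smoothness of `a v₁ + b v₂` on `(-∞,0) × ℝ³`. [folklore] -/
theorem classLinear_smooth {v₁ v₂ : ℝ → ℝ³ → F} (a b : ℝ)
    (h₁ : ContDiffOn ℝ (⊤ : ℕ∞) (uncurry v₁) (Iio 0 ×ˢ univ))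
    (h₂ : ContDiffOn ℝ (⊤ : ℕ∞) (uncurry v₂) (Iio 0 ×ˢ univ)) :
    ContDiffOn ℝ (⊤ : ℕ∞) (uncurry fun t x => a • v₁ t x + b • v₂ t x) (Iio 0 ×ˢ univ) :=
  (h₁.const_smul a).add (h₂.const_smul b)

/-- Conjunct 2: joint smoothness of `a q₁ + b q₂` on `(-∞,0) × ℝ³`. [folklore] -/
theorem classLinear_smooth_scalar {q₁ q₂ : ℝ → ℝ³ → ℝ} (a b : ℝ)
    (h₁ : ContDiffOn ℝ (⊤ : ℕ∞) (uncurry q₁) (Iio 0 ×ˢ univ))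
    (h₂ : ContDiffOn ℝ (⊤ : ℕ∞) (uncurry q₂) (Iio 0 ×ˢ univ)) :
    ContDiffOn ℝ (⊤ : ℕ∞) (uncurry fun t x => a * q₁ t x + b * q₂ t x) (Iio 0 ×ˢ univ) :=
  (contDiffOn_const.mul h₁).add (contDiffOn_const.mul h₂)

end Slices

/-- Conjunct 3: the envelopes of `(a v₁ + b v₂, a q₁ + b q₂)` with constant `|a| K₁ + |b| K₂`. [folklore] -/
theorem classLinear_envelope {v₁ v₂ : ℝ → ℝ³ → ℝ³} {q₁ q₂ : ℝ → ℝ³ → ℝ} (a b : ℝ)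
    (h₁ : ∃ K : ℝ, ∀ t < 0, ∀ x, ‖v₁ t x‖ ≤ K / Real.sqrt (-t) + K / (-t) ∧
      |q₁ t x| ≤ K / (-t) + K * (1 + ‖x‖) / Real.sqrt (-t) ^ 3)
    (h₂ : ∃ K : ℝ, ∀ t < 0, ∀ x, ‖v₂ t x‖ ≤ K / Real.sqrt (-t) + K / (-t) ∧
      |q₂ t x| ≤ K / (-t) + K * (1 + ‖x‖) / Real.sqrt (-t) ^ 3) :
    ∃ K : ℝ, ∀ t < 0, ∀ x, ‖a • v₁ t x + b • v₂ t x‖ ≤ K / Real.sqrt (-t) + K / (-t) ∧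
      |a * q₁ t x + b * q₂ t x| ≤ K / (-t) + K * (1 + ‖x‖) / Real.sqrt (-t) ^ 3 := by
  obtain ⟨K₁, hK₁⟩ := h₁
  obtain ⟨K₂, hK₂⟩ := h₂
  refine ⟨|a| * K₁ + |b| * K₂, fun t ht x => ?_⟩
  obtain ⟨hv₁, hq₁⟩ := hK₁ t ht x
  obtain ⟨hv₂, hq₂⟩ := hK₂ t ht x
  constructor
  · calc ‖a • v₁ t x + b • v₂ t x‖ ≤ |a| * ‖v₁ t x‖ + |b| * ‖v₂ t x‖ := by
          refine (norm_add_le _ _).trans (le_of_eq ?_)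
          rw [norm_smul, norm_smul, Real.norm_eq_abs, Real.norm_eq_abs]
      _ ≤ |a| * (K₁ / Real.sqrt (-t) + K₁ / (-t)) + |b| * (K₂ / Real.sqrt (-t) + K₂ / (-t)) := by
          gcongr
      _ = _ := by ring
  · calc |a * q₁ t x + b * q₂ t x| ≤ |a| * |q₁ t x| + |b| * |q₂ t x| := by
          refine (abs_add_le _ _).trans (le_of_eq ?_)
          rw [abs_mul, abs_mul]
      _ ≤ |a| * (K₁ / (-t) + K₁ * (1 + ‖x‖) / Real.sqrt (-t) ^ 3) +
            |b| * (K₂ / (-t) + K₂ * (1 + ‖x‖) / Real.sqrt (-t) ^ 3) := by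
          gcongr
      _ = _ := by ring

/-- Conjunct 4: `div (a v₁ + b v₂) = 0` — the divergence (trace of the Fréchet derivative) is linear on
differentiable slices. [folklore] -/
theorem classLinear_divFree {v₁ v₂ : ℝ → ℝ³ → ℝ³} (a b : ℝ)
    (h₁ : ContDiffOn ℝ (⊤ : ℕ∞) (uncurry v₁) (Iio 0 ×ˢ univ))
    (h₂ : ContDiffOn ℝ (⊤ : ℕ∞) (uncurry v₂) (Iio 0 ×ˢ univ))
    (hd₁ : ∀ t < 0, VectorCalculus.IsDivFree (v₁ t)) (hd₂ : ∀ t < 0, VectorCalculus.IsDivFree (v₂ t)) :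
    ∀ t < 0, VectorCalculus.IsDivFree fun x => a • v₁ t x + b • v₂ t x := by
  intro t ht x
  have e₁ := hd₁ t ht x
  have e₂ := hd₂ t ht x
  unfold VectorCalculus.divergence at e₁ e₂ ⊢
  rw [(((classLinear_differentiableAt_slice h₁ ht x).hasFDerivAt.fun_const_smul a).fun_add
    ((classLinear_differentiableAt_slice h₂ ht x).hasFDerivAt.fun_const_smul b)).fderiv]
  simp [e₁, e₂]

/-- Conjunct 5: the pointwise linearised momentum equation for `(a v₁ + b v₂, a q₁ + b q₂)` —
`∂ₜ`, `(u·∇)·`, `(·∇)u`, `Δ` and `∇` are linear on the smooth slices. [folklore] -/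
theorem classLinear_momentum {u v₁ v₂ : ℝ → ℝ³ → ℝ³} {q₁ q₂ : ℝ → ℝ³ → ℝ} (a b : ℝ)
    (hv₁ : ContDiffOn ℝ (⊤ : ℕ∞) (uncurry v₁) (Iio 0 ×ˢ univ))
    (hq₁ : ContDiffOn ℝ (⊤ : ℕ∞) (uncurry q₁) (Iio 0 ×ˢ univ))
    (hv₂ : ContDiffOn ℝ (⊤ : ℕ∞) (uncurry v₂) (Iio 0 ×ˢ univ))
    (hq₂ : ContDiffOn ℝ (⊤ : ℕ∞) (uncurry q₂) (Iio 0 ×ˢ univ))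
    (h₁ : ∀ t < 0, ∀ x, timeDeriv v₁ t x + convect (u t) (v₁ t) x + convect (v₁ t) (u t) x =
      Δ (v₁ t) x - gradient (q₁ t) x)
    (h₂ : ∀ t < 0, ∀ x, timeDeriv v₂ t x + convect (u t) (v₂ t) x + convect (v₂ t) (u t) x =
      Δ (v₂ t) x - gradient (q₂ t) x) :
    ∀ t < 0, ∀ x, timeDeriv (fun t x => a • v₁ t x + b • v₂ t x) t x +
      convect (u t) (fun x => a • v₁ t x + b • v₂ t x) x +
      convect (fun x => a • v₁ t x + b • v₂ t x) (u t) x =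
      Δ (fun x => a • v₁ t x + b • v₂ t x) x - gradient (fun x => a * q₁ t x + b * q₂ t x) x := by
  intro t ht x
  have hT : timeDeriv (fun t x => a • v₁ t x + b • v₂ t x) t x =
      a • timeDeriv v₁ t x + b • timeDeriv v₂ t x := by
    simp only [timeDeriv]
    exact (((classLinear_differentiableAt_time hv₁ ht x).hasDerivAt.fun_const_smul a).fun_add
      ((classLinear_differentiableAt_time hv₂ ht x).hasDerivAt.fun_const_smul b)).deriv
  have hC : convect (u t) (fun x => a • v₁ t x + b • v₂ t x) x =
      a • convect (u t) (v₁ t) x + b • convect (u t) (v₂ t) x := by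
    simp only [convect_apply]
    rw [(((classLinear_differentiableAt_slice hv₁ ht x).hasFDerivAt.fun_const_smul a).fun_add
      ((classLinear_differentiableAt_slice hv₂ ht x).hasFDerivAt.fun_const_smul b)).fderiv]
    rfl
  have hC' : convect (fun x => a • v₁ t x + b • v₂ t x) (u t) x =
      a • convect (v₁ t) (u t) x + b • convect (v₂ t) (u t) x := by
    simp only [convect_apply, map_add, map_smul]
  have hL : Δ (fun x => a • v₁ t x + b • v₂ t x) x = a • Δ (v₁ t) x + b • Δ (v₂ t) x := by
    have e₁ : ContDiffAt ℝ 2 (v₁ t) x := (classLinear_contDiffAt_slice hv₁ ht x).of_le (by norm_cast)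
    have e₂ : ContDiffAt ℝ 2 (v₂ t) x := (classLinear_contDiffAt_slice hv₂ ht x).of_le (by norm_cast)
    have e₁' : ContDiffAt ℝ 2 (a • v₁ t) x := e₁.const_smul a
    have e₂' : ContDiffAt ℝ 2 (b • v₂ t) x := e₂.const_smul b
    have hf : (fun x => a • v₁ t x + b • v₂ t x) = a • v₁ t + b • v₂ t := rfl
    rw [hf, e₁'.laplacian_add e₂', laplacian_smul a e₁, laplacian_smul b e₂]
  have hG : gradient (fun x => a * q₁ t x + b * q₂ t x) x =
      a • gradient (q₁ t) x + b • gradient (q₂ t) x := by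
    simp only [gradient]
    rw [(((classLinear_differentiableAt_slice hq₁ ht x).hasFDerivAt.const_mul a).fun_add
      ((classLinear_differentiableAt_slice hq₂ ht x).hasFDerivAt.const_mul b)).fderiv]
    simp only [map_add, map_smulₛₗ, starRingEnd_apply, star_trivial]
  rw [hT, hC, hC', hL, hG]
  linear_combination (norm := module) a • h₁ t ht x + b • h₂ t ht x

/-- On a slab `(s,t) × ℝ³`, `t < 0`, a drift with Type-I time decay is bounded by `|C|/√(-t)`. [folklore] -/
theorem classLinear_drift_bound {C : ℝ} {u : ℝ → ℝ³ → ℝ³} (hu : HasTypeITimeDecay C u)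
    {s t : ℝ} (ht : t < 0) : ∀ τ ∈ Ioo s t, ∀ y, ‖u τ y‖ ≤ |C| / Real.sqrt (-t) := by
  intro τ hτ y
  have hτt := hτ.2
  have h1 : Real.sqrt (-t) ≤ Real.sqrt (-τ) := Real.sqrt_le_sqrt (by linarith)
  have h2 : 0 < Real.sqrt (-t) := Real.sqrt_pos.2 (by linarith)
  calc ‖u τ y‖ ≤ C / Real.sqrt (-τ) := hu τ (hτt.trans ht) y
    _ ≤ |C| / Real.sqrt (-τ) := div_le_div_of_nonneg_right (le_abs_self C) (Real.sqrt_nonneg _)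
    _ ≤ |C| / Real.sqrt (-t) := div_le_div_of_nonneg_left (abs_nonneg C) h2 h1

/-- On a slab `(s,t) × ℝ³`, `t < 0`, a member's velocity is bounded by `|K|/√(-t) + |K|/(-t)`.
[folklore] -/
theorem classLinear_member_bound {K : ℝ} {v : ℝ → ℝ³ → ℝ³} {q : ℝ → ℝ³ → ℝ}
    (hK : ∀ t < 0, ∀ x, ‖v t x‖ ≤ K / Real.sqrt (-t) + K / (-t) ∧
      |q t x| ≤ K / (-t) + K * (1 + ‖x‖) / Real.sqrt (-t) ^ 3) {s t : ℝ} (ht : t < 0) :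
    ∀ τ ∈ Ioo s t, ∀ y, ‖v τ y‖ ≤ |K| / Real.sqrt (-t) + |K| / (-t) := by
  intro τ hτ y
  have hτt := hτ.2
  have h1 : Real.sqrt (-t) ≤ Real.sqrt (-τ) := Real.sqrt_le_sqrt (by linarith)
  have h2 : 0 < Real.sqrt (-t) := Real.sqrt_pos.2 (by linarith)
  calc ‖v τ y‖ ≤ K / Real.sqrt (-τ) + K / (-τ) := (hK τ (hτt.trans ht) y).1
    _ ≤ |K| / Real.sqrt (-τ) + |K| / (-τ) :=
        add_le_add (div_le_div_of_nonneg_right (le_abs_self K) (Real.sqrt_nonneg _))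
          (div_le_div_of_nonneg_right (le_abs_self K) (by linarith))
    _ ≤ |K| / Real.sqrt (-t) + |K| / (-t) :=
        add_le_add (div_le_div_of_nonneg_left (abs_nonneg K) h2 h1)
          (div_le_div_of_nonneg_left (abs_nonneg K) (by linarith) (by linarith))

/-- **Absolute convergence of the Oseen–Duhamel integrand** of fields continuous on `(-∞,0) × ℝ³` and
bounded on the slab `(s,t) × ℝ³`, `s < t < 0` (KNSS 2009, §4 p. 8; the tree's
`integrable_oseenKernel_duhamel_bounded` at viscosity `1`). [folklore] -/
theorem classLinear_integrable_duhamel {u w : ℝ → ℝ³ → ℝ³} {s t Mu Mw : ℝ} (hst : s < t) (ht : t < 0)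
    (hu : ContinuousOn (uncurry u) (Iio 0 ×ˢ univ)) (hw : ContinuousOn (uncurry w) (Iio 0 ×ˢ univ))
    (huM : ∀ τ ∈ Ioo s t, ∀ y, ‖u τ y‖ ≤ Mu) (hwM : ∀ τ ∈ Ioo s t, ∀ y, ‖w τ y‖ ≤ Mw) (x : ℝ³) :
    Integrable (fun p : ℝ × ℝ³ => oseenKernel (t - p.1) (x - p.2) (u p.1 p.2) (w p.1 p.2))
      ((volume : Measure (ℝ × ℝ³)).restrict (Ioo s t ×ˢ univ)) := by
  have hsub : Ioo s t ×ˢ (univ : Set ℝ³) ⊆ Iio 0 ×ˢ univ :=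
    prod_mono (fun τ hτ => (hτ.2.trans ht : τ < 0)) subset_rfl
  have hmeas : ∀ {f : ℝ → ℝ³ → ℝ³}, ContinuousOn (uncurry f) (Iio 0 ×ˢ univ) →
      AEStronglyMeasurable (uncurry f) ((volume : Measure (ℝ × ℝ³)).restrict (Ioo s t ×ˢ univ)) :=
    fun hf => (hf.mono hsub).aestronglyMeasurable (measurableSet_Ioo.prod MeasurableSet.univ)
  have huM' : ∀ τ ∈ Ioo s t, ∀ y, ‖u τ y‖ ≤ |Mu| + |Mw| := fun τ hτ y =>
    (huM τ hτ y).trans ((le_abs_self _).trans (le_add_of_nonneg_right (abs_nonneg _)))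
  have hwM' : ∀ τ ∈ Ioo s t, ∀ y, ‖w τ y‖ ≤ |Mu| + |Mw| := fun τ hτ y =>
    (hwM τ hτ y).trans ((le_abs_self _).trans (le_add_of_nonneg_left (abs_nonneg _)))
  have h := integrable_oseenKernel_duhamel_bounded (ν := 1) one_pos (hmeas hu) (hmeas hw)
    (by positivity : (0 : ℝ) ≤ |Mu| + |Mw|) huM' hwM' hst le_rfl x
  simpa only [one_mul] using h

/-- **The symmetrised Oseen–Duhamel double integral is linear in the member**: for a drift `u` and members
`w₁`, `w₂` continuous on `(-∞,0) × ℝ³` and bounded on `(s,t) × ℝ³`, `s < t < 0`, the kernel is bilinear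
pointwise (Koch–Tataru 2001, (11)) and both levels of the iterated integral converge absolutely (Fubini
slices and marginal of `classLinear_integrable_duhamel`), so `∫∫` splits. [folklore] -/
theorem classLinear_duhamel_split {u w₁ w₂ : ℝ → ℝ³ → ℝ³} {s t Mu M₁ M₂ : ℝ} (a b : ℝ) (hst : s < t)
    (ht : t < 0) (hu : ContinuousOn (uncurry u) (Iio 0 ×ˢ univ))
    (hw₁ : ContinuousOn (uncurry w₁) (Iio 0 ×ˢ univ)) (hw₂ : ContinuousOn (uncurry w₂) (Iio 0 ×ˢ univ))
    (huM : ∀ τ ∈ Ioo s t, ∀ y, ‖u τ y‖ ≤ Mu) (h₁M : ∀ τ ∈ Ioo s t, ∀ y, ‖w₁ τ y‖ ≤ M₁)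
    (h₂M : ∀ τ ∈ Ioo s t, ∀ y, ‖w₂ τ y‖ ≤ M₂) (x : ℝ³) :
    ∫ τ in Ioo s t, ∫ y, (oseenKernel (t - τ) (x - y) (u τ y) (a • w₁ τ y + b • w₂ τ y) +
        oseenKernel (t - τ) (x - y) (a • w₁ τ y + b • w₂ τ y) (u τ y)) =
      a • (∫ τ in Ioo s t, ∫ y, (oseenKernel (t - τ) (x - y) (u τ y) (w₁ τ y) +
          oseenKernel (t - τ) (x - y) (w₁ τ y) (u τ y))) +
        b • (∫ τ in Ioo s t, ∫ y, (oseenKernel (t - τ) (x - y) (u τ y) (w₂ τ y) +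
          oseenKernel (t - τ) (x - y) (w₂ τ y) (u τ y))) := by
  have hI₁ : Integrable (fun p : ℝ × ℝ³ => oseenKernel (t - p.1) (x - p.2) (u p.1 p.2) (w₁ p.1 p.2) +
      oseenKernel (t - p.1) (x - p.2) (w₁ p.1 p.2) (u p.1 p.2))
      (((volume : Measure ℝ).restrict (Ioo s t)).prod (volume : Measure ℝ³)) := by
    rw [← volume_restrict_prod_univ_eq_prod]
    exact (classLinear_integrable_duhamel hst ht hu hw₁ huM h₁M x).add
      (classLinear_integrable_duhamel hst ht hw₁ hu h₁M huM x)
  have hI₂ : Integrable (fun p : ℝ × ℝ³ => oseenKernel (t - p.1) (x - p.2) (u p.1 p.2) (w₂ p.1 p.2) +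
      oseenKernel (t - p.1) (x - p.2) (w₂ p.1 p.2) (u p.1 p.2))
      (((volume : Measure ℝ).restrict (Ioo s t)).prod (volume : Measure ℝ³)) := by
    rw [← volume_restrict_prod_univ_eq_prod]
    exact (classLinear_integrable_duhamel hst ht hu hw₂ huM h₂M x).add
      (classLinear_integrable_duhamel hst ht hw₂ hu h₂M huM x)
  have hin : ∀ᵐ τ ∂((volume : Measure ℝ).restrict (Ioo s t)),
      ∫ y, (oseenKernel (t - τ) (x - y) (u τ y) (a • w₁ τ y + b • w₂ τ y) +
          oseenKernel (t - τ) (x - y) (a • w₁ τ y + b • w₂ τ y) (u τ y)) =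
        a • (∫ y, (oseenKernel (t - τ) (x - y) (u τ y) (w₁ τ y) +
            oseenKernel (t - τ) (x - y) (w₁ τ y) (u τ y))) +
          b • (∫ y, (oseenKernel (t - τ) (x - y) (u τ y) (w₂ τ y) +
            oseenKernel (t - τ) (x - y) (w₂ τ y) (u τ y))) := by
    filter_upwards [hI₁.prod_right_ae, hI₂.prod_right_ae] with τ hτ₁ hτ₂
    have g₁ : Integrable (fun y => a • (oseenKernel (t - τ) (x - y) (u τ y) (w₁ τ y) +
        oseenKernel (t - τ) (x - y) (w₁ τ y) (u τ y))) volume := hτ₁.smul a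
    have g₂ : Integrable (fun y => b • (oseenKernel (t - τ) (x - y) (u τ y) (w₂ τ y) +
        oseenKernel (t - τ) (x - y) (w₂ τ y) (u τ y))) volume := hτ₂.smul b
    have hpt : (fun y => oseenKernel (t - τ) (x - y) (u τ y) (a • w₁ τ y + b • w₂ τ y) +
        oseenKernel (t - τ) (x - y) (a • w₁ τ y + b • w₂ τ y) (u τ y)) =
        fun y => a • (oseenKernel (t - τ) (x - y) (u τ y) (w₁ τ y) +
          oseenKernel (t - τ) (x - y) (w₁ τ y) (u τ y)) +
          b • (oseenKernel (t - τ) (x - y) (u τ y) (w₂ τ y) +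
            oseenKernel (t - τ) (x - y) (w₂ τ y) (u τ y)) := by
      funext y
      simp only [oseenKernel_add_right, oseenKernel_add_left, oseenKernel_smul_right,
        oseenKernel_smul_left, smul_add]
      abel
    rw [hpt, integral_add g₁ g₂, integral_smul, integral_smul]
  have J₁ : Integrable (fun τ => a • ∫ y, (oseenKernel (t - τ) (x - y) (u τ y) (w₁ τ y) +
      oseenKernel (t - τ) (x - y) (w₁ τ y) (u τ y))) ((volume : Measure ℝ).restrict (Ioo s t)) :=
    hI₁.integral_prod_left.smul a
  have J₂ : Integrable (fun τ => b • ∫ y, (oseenKernel (t - τ) (x - y) (u τ y) (w₂ τ y) +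
      oseenKernel (t - τ) (x - y) (w₂ τ y) (u τ y))) ((volume : Measure ℝ).restrict (Ioo s t)) :=
    hI₂.integral_prod_left.smul b
  rw [integral_congr_ae hin, integral_add J₁ J₂, integral_smul, integral_smul]

/-- `e^{σΔ}` is linear on bounded continuous data (`heatFlow = heatExtension` for `σ > 0`, a Bochner
integral against the integrable heat kernel). [folklore] -/
theorem classLinear_heatFlow_split {φ₁ φ₂ : ℝ³ → ℝ³} (a b : ℝ) (h₁ : Continuous φ₁) (h₂ : Continuous φ₂)
    {M₁ M₂ : ℝ} (hM₁ : ∀ y, ‖φ₁ y‖ ≤ M₁) (hM₂ : ∀ y, ‖φ₂ y‖ ≤ M₂) {σ : ℝ} (hσ : 0 < σ) (x : ℝ³) :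
    heatFlow (fun y => a • φ₁ y + b • φ₂ y) σ x = a • heatFlow φ₁ σ x + b • heatFlow φ₂ σ x := by
  simp only [heatFlow_of_pos _ hσ]
  rw [UnboundedOperators.heatExtension_add_of_bound (g := fun y => a • φ₁ y) (h := fun y => b • φ₂ y)
    (h₁.const_smul a) (h₂.const_smul b)
    (fun y => (norm_smul_le a (φ₁ y)).trans (mul_le_mul_of_nonneg_left (hM₁ y) (norm_nonneg a)))
    (fun y => (norm_smul_le b (φ₂ y)).trans (mul_le_mul_of_nonneg_left (hM₂ y) (norm_nonneg b))) hσ x,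
    UnboundedOperators.heatExtension_const_smul, UnboundedOperators.heatExtension_const_smul]

/-- Conjunct 6: the linearised Oseen identity for `a v₁ + b v₂` — `e^{(t-s)Δ}` is linear on the bounded
continuous slices at time `s`, and the symmetrised Duhamel double integral is linear in the member
(`classLinear_duhamel_split`; on `(s,t) ⊂ (-∞,0)` the drift is bounded by `|C|/√(-t)` and the members
by `|Kᵢ|/√(-t) + |Kᵢ|/(-t)`). [folklore] -/
theorem classLinear_oseen {C : ℝ} {u v₁ v₂ : ℝ → ℝ³ → ℝ³} {q₁ q₂ : ℝ → ℝ³ → ℝ} (a b : ℝ)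
    (hu : ContDiffOn ℝ (⊤ : ℕ∞) (uncurry u) (Iio 0 ×ˢ univ)) (hC : HasTypeITimeDecay C u)
    (hv₁ : ContDiffOn ℝ (⊤ : ℕ∞) (uncurry v₁) (Iio 0 ×ˢ univ))
    (hK₁ : ∃ K : ℝ, ∀ t < 0, ∀ x, ‖v₁ t x‖ ≤ K / Real.sqrt (-t) + K / (-t) ∧
      |q₁ t x| ≤ K / (-t) + K * (1 + ‖x‖) / Real.sqrt (-t) ^ 3)
    (hO₁ : ∀ s t : ℝ, s < t → t < 0 → ∀ x, v₁ t x = heatFlow (v₁ s) (t - s) x -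
      ∫ τ in Ioo s t, ∫ y, (oseenKernel (t - τ) (x - y) (u τ y) (v₁ τ y) +
        oseenKernel (t - τ) (x - y) (v₁ τ y) (u τ y)))
    (hv₂ : ContDiffOn ℝ (⊤ : ℕ∞) (uncurry v₂) (Iio 0 ×ˢ univ))
    (hK₂ : ∃ K : ℝ, ∀ t < 0, ∀ x, ‖v₂ t x‖ ≤ K / Real.sqrt (-t) + K / (-t) ∧
      |q₂ t x| ≤ K / (-t) + K * (1 + ‖x‖) / Real.sqrt (-t) ^ 3)
    (hO₂ : ∀ s t : ℝ, s < t → t < 0 → ∀ x, v₂ t x = heatFlow (v₂ s) (t - s) x -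
      ∫ τ in Ioo s t, ∫ y, (oseenKernel (t - τ) (x - y) (u τ y) (v₂ τ y) +
        oseenKernel (t - τ) (x - y) (v₂ τ y) (u τ y))) :
    ∀ s t : ℝ, s < t → t < 0 → ∀ x, a • v₁ t x + b • v₂ t x =
      heatFlow (fun y => a • v₁ s y + b • v₂ s y) (t - s) x -
      ∫ τ in Ioo s t, ∫ y, (oseenKernel (t - τ) (x - y) (u τ y) (a • v₁ τ y + b • v₂ τ y) +
        oseenKernel (t - τ) (x - y) (a • v₁ τ y + b • v₂ τ y) (u τ y)) := by
  intro s t hst ht x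
  obtain ⟨K₁, hK₁⟩ := hK₁
  obtain ⟨K₂, hK₂⟩ := hK₂
  have hs : s < 0 := hst.trans ht
  rw [classLinear_heatFlow_split a b (classLinear_continuous_slice hv₁ hs)
      (classLinear_continuous_slice hv₂ hs) (fun y => (hK₁ s hs y).1) (fun y => (hK₂ s hs y).1)
      (sub_pos.2 hst) x,
    classLinear_duhamel_split a b hst ht hu.continuousOn hv₁.continuousOn hv₂.continuousOn
      (classLinear_drift_bound hC ht) (classLinear_member_bound hK₁ ht)
      (classLinear_member_bound hK₂ ht) x,
    hO₁ s t hst ht x, hO₂ s t hst ht x]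
  simp only [smul_sub]
  abel

/-- **Stub 1 (M) — linear closure of the class.** Every conjunct of the class is linear in `(v, q)`:
smoothness, the envelopes (constants `|a|K₁ + |b|K₂`), `div`, the pointwise linearised momentum
equation (`timeDeriv`, `convect`, `Δ`, `gradient` are additive on the smooth slices), and the
linearised Oseen identity — `heatFlow` is linear on bounded continuous data and the double Oseen
integral of bounded continuous slices converges absolutely (Koch–Tataru bound (14): tree
`integrable_oseenKernel_sub_of_bounded`, `OseenDuhamelMeasurable`), so `∫∫` splits. The drift
hypotheses supply continuity and the bound `‖u(τ,·)‖ ≤ C/√(−τ)` on `τ < 0`. Stated with the six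
conjuncts of `InTangentClass` spelled out. -/
theorem stub_classLinear : ∀ (C : ℝ) (u : ℝ → ℝ³ → ℝ³),
    ContDiffOn ℝ (⊤ : ℕ∞) (Function.uncurry u) (Set.Iio 0 ×ˢ Set.univ) →
    HasTypeITimeDecay C u →
    ∀ (v₁ : ℝ → ℝ³ → ℝ³) (q₁ : ℝ → ℝ³ → ℝ) (v₂ : ℝ → ℝ³ → ℝ³) (q₂ : ℝ → ℝ³ → ℝ) (a b : ℝ),
    ContDiffOn ℝ (⊤ : ℕ∞) (Function.uncurry v₁) (Set.Iio 0 ×ˢ Set.univ) →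
    ContDiffOn ℝ (⊤ : ℕ∞) (Function.uncurry q₁) (Set.Iio 0 ×ˢ Set.univ) →
    (∃ K : ℝ, ∀ t < 0, ∀ x, ‖v₁ t x‖ ≤ K / Real.sqrt (-t) + K / (-t) ∧
      |q₁ t x| ≤ K / (-t) + K * (1 + ‖x‖) / Real.sqrt (-t) ^ 3) →
    (∀ t < 0, VectorCalculus.IsDivFree (v₁ t)) →
    (∀ t < 0, ∀ x, timeDeriv v₁ t x + convect (u t) (v₁ t) x + convect (v₁ t) (u t) x =
      Δ (v₁ t) x - gradient (q₁ t) x) →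
    (∀ s t : ℝ, s < t → t < 0 → ∀ x, v₁ t x = heatFlow (v₁ s) (t - s) x -
      ∫ τ in Set.Ioo s t, ∫ y, (oseenKernel (t - τ) (x - y) (u τ y) (v₁ τ y) +
        oseenKernel (t - τ) (x - y) (v₁ τ y) (u τ y))) →
    ContDiffOn ℝ (⊤ : ℕ∞) (Function.uncurry v₂) (Set.Iio 0 ×ˢ Set.univ) →
    ContDiffOn ℝ (⊤ : ℕ∞) (Function.uncurry q₂) (Set.Iio 0 ×ˢ Set.univ) →
    (∃ K : ℝ, ∀ t < 0, ∀ x, ‖v₂ t x‖ ≤ K / Real.sqrt (-t) + K / (-t) ∧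
      |q₂ t x| ≤ K / (-t) + K * (1 + ‖x‖) / Real.sqrt (-t) ^ 3) →
    (∀ t < 0, VectorCalculus.IsDivFree (v₂ t)) →
    (∀ t < 0, ∀ x, timeDeriv v₂ t x + convect (u t) (v₂ t) x + convect (v₂ t) (u t) x =
      Δ (v₂ t) x - gradient (q₂ t) x) →
    (∀ s t : ℝ, s < t → t < 0 → ∀ x, v₂ t x = heatFlow (v₂ s) (t - s) x -
      ∫ τ in Set.Ioo s t, ∫ y, (oseenKernel (t - τ) (x - y) (u τ y) (v₂ τ y) +
        oseenKernel (t - τ) (x - y) (v₂ τ y) (u τ y))) →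
    (ContDiffOn ℝ (⊤ : ℕ∞) (Function.uncurry fun t x => a • v₁ t x + b • v₂ t x) (Set.Iio 0 ×ˢ Set.univ) ∧
    ContDiffOn ℝ (⊤ : ℕ∞) (Function.uncurry fun t x => a * q₁ t x + b * q₂ t x) (Set.Iio 0 ×ˢ Set.univ) ∧
    (∃ K : ℝ, ∀ t < 0, ∀ x, ‖a • v₁ t x + b • v₂ t x‖ ≤ K / Real.sqrt (-t) + K / (-t) ∧
      |a * q₁ t x + b * q₂ t x| ≤ K / (-t) + K * (1 + ‖x‖) / Real.sqrt (-t) ^ 3) ∧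
    (∀ t < 0, VectorCalculus.IsDivFree fun x => a • v₁ t x + b • v₂ t x) ∧
    (∀ t < 0, ∀ x, timeDeriv (fun t x => a • v₁ t x + b • v₂ t x) t x +
      convect (u t) (fun x => a • v₁ t x + b • v₂ t x) x +
      convect (fun x => a • v₁ t x + b • v₂ t x) (u t) x =
      Δ (fun x => a • v₁ t x + b • v₂ t x) x - gradient (fun x => a * q₁ t x + b * q₂ t x) x) ∧
    (∀ s t : ℝ, s < t → t < 0 → ∀ x, a • v₁ t x + b • v₂ t x =
      heatFlow (fun y => a • v₁ s y + b • v₂ s y) (t - s) x -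
      ∫ τ in Set.Ioo s t, ∫ y, (oseenKernel (t - τ) (x - y) (u τ y) (a • v₁ τ y + b • v₂ τ y) +
        oseenKernel (t - τ) (x - y) (a • v₁ τ y + b • v₂ τ y) (u τ y)))) := by
  intro C u hu hC v₁ q₁ v₂ q₂ a b hv₁ hq₁ hK₁ hd₁ hm₁ hO₁ hv₂ hq₂ hK₂ hd₂ hm₂ hO₂
  exact ⟨classLinear_smooth a b hv₁ hv₂, classLinear_smooth_scalar a b hq₁ hq₂,
    classLinear_envelope a b hK₁ hK₂, classLinear_divFree a b hv₁ hv₂ hd₁ hd₂,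
    classLinear_momentum a b hv₁ hq₁ hv₂ hq₂ hm₁ hm₂,
    classLinear_oseen a b hu hC hv₁ hK₁ hO₁ hv₂ hK₂ hO₂⟩

end Summit.NavierStokesRegularity.NavierStokesRegularity.Theorems

end
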